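import Literature.NumberTheory.EllipticCurves.IwasawaLocalKummerSkeletonProofs
import HarnessLib

/-!
# `p`-power-torsion classes of a restriction kernel vanish when the fixed points have no `p`-torsion
# (the two anomalous factors of Greenberg's Lemma 3.4, in the twisted case where both are `1`)

HONEST FRAMING (cell `b2b-bsdres`, run/shared/lean/b2b/bsd-rank1-residual/, verbatim in every
file): the goal of the cell is to DELETE the COMBINATION-SHAPED residual classes of the
Birch–Swinnerton-Dyer formula for ALL analytic-rank `≤ 1` elliptic curves over `ℚ` — "full BSD
formula for every rank `≤ 1` curve in class `C`" assembled STRICTLY from published theorems — so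
that the rank-`≤ 1` remainder becomes exactly the CONSTRUCTION-SHAPED classes, which are TYPED
(missing-input `Prop`s), NOT attempted. This is not "finishing BSD". Team n1011 (N10/N11; row
T-T3B = the `v = p` local tower kernel at level `0` for additive potentially good ordinary
reduction, skeleton `cells/n1011/skel/T-T3B.md`): research routes on CONSTRUCTION-SHAPED classes;
prove what is provable now; no claim beyond stated classes; census output = EVIDENCE, never a
Literature fact; RESIDUAL-MAP marks UNCHANGED; nothing is booked by this file. TOOL THEOREMS ONLY:
no definition, no named fact, nothing cited enters as a hypothesis.

## What (file F1 of row T-T3B; generic topological-group cohomology, no arithmetic)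

R. Greenberg, *Iwasawa theory for elliptic curves*, LNM 1716 (1999), §3 Lemma 3.4 (p. 89): for
`E/F_v` good ordinary at `v ∣ p`, `#ker(r_v) = #Ẽ(f_v)(p)²`; the two factors are `#H¹(Γ, D(F_∞,η))`
(the étale quotient `D = E[p^∞]/C`) and the index of the Kummer image in `Im H¹(F_v, C)`. The
tree's skeleton `ResKernel.finite_primary_subgroupResKer_of_reduction`
(`IwasawaLocalKummerSkeletonProofs`) proves FINITENESS of the `p`-power torsion of
`ker (H¹(G, A) → H¹(N, A))` from upper bounds. This file isolates the VANISHING statements needed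
when both anomalous factors are `1` — the situation of an additive potentially good ordinary curve
over `ℚ_p`, whose étale quotient carries a RAMIFIED character, so that `D(ℚ_{p,∞}) = 0`:

* `ResKernelPrimary.eq_zero_of_pow_smul_eq_zero` — for `N ⊴ G` and `γ` generating `G`
  topologically together with `N`, and a discrete TORSION `G`-module `M` whose `N`-fixed points have
  NO element killed by `p` other than `0`: every `x ∈ ker (H¹(G, M) → H¹(N, M))` with
  `p ^ k • x = 0` is `0` (the embedding `ker res ↪ M^N/(γ − 1)M^N` of
  `ResKernel.oneCocycleClass_eq_of_sub_eq`: `p^k φ(γ) = (γ − 1)v` with `φ(γ)` of order prime to `p`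
  gives `φ(γ) ∈ (γ − 1)M^N`).
* `ResKernelPrimary.exists_kerValued_cocycle_of_pow_smul_eq_zero` — the dévissage form: for a
  `G`-stable subgroup `A₁ ≤ A` ("the kernel of reduction of a good model") with `A` and `A₁`
  `p`-divisible, `A/A₁` torsion, and NO `p`-torsion in `(A/A₁)^N`
  (`hnp : (∀ n ∈ N, n • a − a ∈ A₁) → p • a ∈ A₁ → a ∈ A₁`), every
  `x ∈ ker (H¹(G, A) → H¹(N, A))` with `p ^ k • x = 0` is the class of a cocycle with values in
  `A₁ ∩ A[p^m]` (push forward to `Ā = A/A₁`, apply the first theorem, then the tree's Step 3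
  `ResKernel.exists_cocycle_ker_valued`).
* `ResKernelPrimary.exists_kerValued_cocycle_of_pow_smul_eq_zero_of_red` — the same with an
  abstract equivariant surjection `red : A → Ā` in place of `A₁ = ker red`.

No arithmetic input; the discharge (`D[p]^{(ker κ)_p} = 0` for the ramified quotient character,
the Kummer count killing `H¹(ℚ_p, A₁)`) is the business of the row's files F3–F5.

References: [GreenbergLNM1716] R. Greenberg, LNM 1716 (1999), §3 Lemma 3.1 (p. 86), Lemma 3.4
(p. 89, diagram (5)); J.-P. Serre, *Galois Cohomology* (1997), I.§2.6, I.§5.1.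
-/

noncomputable section

open scoped Classical

open CategoryTheory Literature.NumberTheory.EllipticCurves Literature.NumberTheory.GaloisRepresentations
  Literature.NumberTheory.EllipticCurves.ResKernel

universe u

namespace Summit.BirchSwinnertonDyer.Rank1Residual.Iwasawa

namespace ResKernelPrimary

variable {G : Type u} [Group G] [TopologicalSpace G] [IsTopologicalGroup G]
variable {M : Type u} [AddCommGroup M] [DistribMulAction G M] [TopologicalSpace M]
  [DiscreteTopology M]

/-! ## §1 No `p`-torsion in `M^N` ⟹ no `p`-power torsion in `ker (H¹(G, M) → H¹(N, M))` -/

omit [TopologicalSpace G] [IsTopologicalGroup G] [TopologicalSpace M] [DiscreteTopology M] in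
/-- An element of finite order in a subgroup without elements of order `p` has order prime to `p`:
if `p ∣ ord(a)` then `(ord(a)/p) • a` is a non-zero element killed by `p`. [folklore] -/
theorem not_dvd_addOrderOf_of_forall (p : ℕ) [hp : Fact p.Prime] (B : AddSubgroup M)
    (hnp : ∀ m ∈ B, p • m = 0 → m = 0) {a : M} (ha : a ∈ B) (hfin : IsOfFinAddOrder a) :
    ¬ p ∣ addOrderOf a := by
  intro hdvd
  obtain ⟨q, hq⟩ := hdvd
  have hpos : 0 < addOrderOf a := hfin.addOrderOf_pos
  have hq0 : 0 < q := Nat.pos_of_ne_zero (by rintro rfl; rw [mul_zero] at hq; omega)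
  have hb : p • (q • a) = 0 := by
    rw [smul_smul, ← hq]; exact addOrderOf_nsmul_eq_zero a
  have hb0 : q • a = 0 := hnp _ (B.nsmul_mem ha q) hb
  have hdvd' : addOrderOf a ∣ q := addOrderOf_dvd_iff_nsmul_eq_zero.mpr hb0
  have hle : addOrderOf a ≤ q := Nat.le_of_dvd hq0 hdvd'
  have hlt : q < addOrderOf a := by
    rw [hq]
    exact lt_mul_left hq0 hp.out.one_lt
  omega

/-- **`p`-power-torsion classes of `ker (H¹(G, M) → H¹(N, M))` vanish when `M^N` has no
`p`-torsion.** Let `N ⊴ G`, `γ ∈ G` with `N` and `γ` generating `G` topologically, `M` a discrete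
torsion `G`-module with continuous orbit maps such that the only `N`-fixed element killed by `p` is
`0`. If `x ∈ subgroupResKer M N` and `p ^ k • x = 0`, then `x = 0`. Proof: `x = [φ]` with `φ|_N = 0`
(`ResKernel.exists_cocycle_of_res_eq_zero`); `p^k • x = 0` gives `p^k • φ(g) = g • v − v` for some
`v`, which is `N`-fixed since `φ` vanishes on `N`; `a = φ(γ) ∈ M^N` has finite order `m` prime to
`p` (`not_dvd_addOrderOf_of_forall`), so `α p^k + β m = 1` gives `a = γ • (α • v) − α • v`, and
`ResKernel.oneCocycleClass_eq_of_sub_eq` (the injection `ker res ↪ M^N/(γ − 1)M^N` of Greenberg's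
Lemma 3.1) identifies `[φ]` with `[0] = 0`. This is the vanishing of the factor
`#H¹(Γ, D(F_{∞,η})) = #D(F_v)(p)` of Lemma 3.4 when `D^N` has no `p`-torsion.
[cite: GreenbergLNM1716, §3 Lemma 3.1 (p. 86) and Lemma 3.4 (p. 89)] -/
theorem eq_zero_of_pow_smul_eq_zero (N : Subgroup G) [N.Normal] (γ : G)
    (hgen : ∀ U : Subgroup G, IsOpen (U : Set G) → N ≤ U → γ ∈ U → U = ⊤)
    (hcont : ∀ m : M, Continuous fun g : G ↦ g • m) (p : ℕ) [hp : Fact p.Prime]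
    (htor : ∀ m : M, IsOfFinAddOrder m)
    (hnp : ∀ m : M, (∀ n ∈ N, n • m = m) → p • m = 0 → m = 0)
    {x : discreteH1 G M} (hx : x ∈ subgroupResKer M N) {k : ℕ} (hk : p ^ k • x = 0) :
    x = 0 := by
  obtain ⟨φ, rfl, hφN⟩ := exists_cocycle_of_res_eq_zero N M hcont x
    ((mem_subgroupResKer_iff N M x).mp hx)
  -- `p^k • φ = ∂v`
  have h0 : oneCocycleClass _ (((p ^ k : ℕ) : ℤ) • φ) = 0 := by
    rw [oneCocycleClass_smul, Nat.cast_smul_eq_nsmul, hk]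
  obtain ⟨v, hv⟩ := (oneCocycleClass_eq_zero_iff _ _).mp h0
  have hv' : ∀ g : G, p ^ k • φ.1 g = g • v - v := fun g ↦ by
    have h := hv g
    rw [coe_zsmul_cocycle_apply, Nat.cast_smul_eq_nsmul] at h
    exact h
  -- `v ∈ M^N`
  have hvN : v ∈ FixedPoints.addSubgroup N M := by
    intro n
    have h := hv' (n : G)
    rw [hφN _ n.2, smul_zero] at h
    exact (sub_eq_zero.mp h.symm)
  have hnpB : ∀ m ∈ FixedPoints.addSubgroup N M, p • m = 0 → m = 0 :=
    fun m hm hpm ↦ hnp m (fun n hn ↦ hm ⟨n, hn⟩) hpm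
  -- `a = φ γ ∈ M^N` has order prime to `p`
  have haN : φ.1 γ ∈ FixedPoints.addSubgroup N M := apply_mem_fixedPoints N M φ hφN γ
  have hcop : ¬ p ∣ addOrderOf (φ.1 γ) :=
    not_dvd_addOrderOf_of_forall p _ hnpB haN (htor _)
  have hcopZ : IsCoprime ((p : ℤ) ^ k) (addOrderOf (φ.1 γ) : ℤ) := by
    rw [← Nat.cast_pow, Nat.isCoprime_iff_coprime]
    exact Nat.Coprime.pow_left _ ((Nat.Prime.coprime_iff_not_dvd hp.out).mpr hcop)
  obtain ⟨α, β, hαβ⟩ := hcopZ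
  -- `a = (γ - 1)(α • v)`
  have hαv : α • v ∈ FixedPoints.addSubgroup N M := AddSubgroup.zsmul_mem _ hvN α
  have key : φ.1 γ - (0 : contOneCocycles (discreteTopRep G M)).1 γ = γ • (α • v) - α • v := by
    have h1 : φ.1 γ = (α * (p : ℤ) ^ k + β * (addOrderOf (φ.1 γ) : ℤ)) • φ.1 γ := by
      rw [hαβ, one_smul]
    have h2 : ((addOrderOf (φ.1 γ) : ℕ) : ℤ) • φ.1 γ = 0 := by
      rw [natCast_zsmul]; exact addOrderOf_nsmul_eq_zero _
    rw [ZeroMemClass.coe_zero, ContinuousMap.zero_apply, sub_zero]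
    rw [add_smul, mul_smul, mul_smul, h2, smul_zero, add_zero, ← Nat.cast_pow, natCast_zsmul,
      hv' γ, smul_sub, smul_comm] at h1
    exact h1
  have hcl := oneCocycleClass_eq_of_sub_eq N M γ hgen hcont φ 0 hφN (fun _ _ ↦ rfl) hαv key
  rw [hcl]
  exact oneCocycleClass_zero _

/-! ## §2 The dévissage form: classes killed by restriction are `A₁ ∩ A[p^m]`-valued -/

variable {A : Type u} [AddCommGroup A] [DistribMulAction G A] [TopologicalSpace A]
  [DiscreteTopology A]
variable {Ā : Type u} [AddCommGroup Ā] [DistribMulAction G Ā] [TopologicalSpace Ā]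
  [DiscreteTopology Ā]

/-- **Dévissage along an equivariant surjection `red : A → Ā`.** Let `N ⊴ G`, `γ` with `N` and `γ`
generating `G` topologically, `A`, `Ā` discrete `G`-modules with continuous orbit maps, `red`
equivariant and onto, `A` `p`-divisible, `ker red` `p`-divisible, `Ā` torsion, and suppose the only
`N`-fixed element of `Ā` killed by `p` is `0`. Then every `x ∈ ker (H¹(G, A) → H¹(N, A))` with
`p ^ k • x = 0` is represented by a cocycle `ψ` with `p ^ m • ψ = 0` pointwise and `red ∘ ψ = 0`:
a `p^k`-torsion representative (`ResKernel.exists_cocycle_nsmul_eq_zero_of_nsmul_class_eq_zero`) is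
pushed to `ker (H¹(G, Ā) → H¹(N, Ā))` (`ResKernel.resH1Hom_id_mem_subgroupResKer`), where it dies by
`eq_zero_of_pow_smul_eq_zero`; then the tree's Step 3 (`ResKernel.exists_cocycle_ker_valued`).
Greenberg's diagram (5) (LNM 1716 p. 89) with `ker(d_v) = 0`.
[cite: GreenbergLNM1716, §3 Lemma 3.4 (p. 89, diagram (5))] -/
theorem exists_kerValued_cocycle_of_pow_smul_eq_zero_of_red (N : Subgroup G) [N.Normal] (γ : G)
    (hgen : ∀ U : Subgroup G, IsOpen (U : Set G) → N ≤ U → γ ∈ U → U = ⊤)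
    (hcont : ∀ a : A, Continuous fun g : G ↦ g • a)
    (hcontĀ : ∀ ā : Ā, Continuous fun g : G ↦ g • ā)
    (red : A →+ Ā) (hred : ∀ (g : G) (a : A), red (g • a) = g • red a)
    (hsurj : Function.Surjective red) (p : ℕ) [hp : Fact p.Prime]
    (hdiv : ∀ a : A, ∃ b : A, p • b = a)
    (hdiv₁ : ∀ a : A, red a = 0 → ∃ b : A, red b = 0 ∧ p • b = a)
    (htor : ∀ ā : Ā, IsOfFinAddOrder ā)
    (hnp : ∀ ā : Ā, (∀ n ∈ N, n • ā = ā) → p • ā = 0 → ā = 0)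
    {x : discreteH1 G A} (hx : x ∈ subgroupResKer A N) {k : ℕ} (hk : p ^ k • x = 0) :
    ∃ (m : ℕ) (ψ : contOneCocycles (discreteTopRep G A)),
      oneCocycleClass _ ψ = x ∧ (∀ g, p ^ m • ψ.1 g = 0) ∧ ∀ g, red (ψ.1 g) = 0 := by
  obtain ⟨ψ, rfl, hψp⟩ := exists_cocycle_nsmul_eq_zero_of_nsmul_class_eq_zero hcont p hdiv hk
  -- the push-forward dies in `H¹(G, Ā)`
  have hmem : resH1Hom (ContinuousMonoidHom.id G) red (compat_id_of_equivariant red hred)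
      (oneCocycleClass _ ψ) ∈ subgroupResKer Ā N :=
    resH1Hom_id_mem_subgroupResKer red hred N hx
  have hpk : p ^ k • resH1Hom (ContinuousMonoidHom.id G) red (compat_id_of_equivariant red hred)
      (oneCocycleClass _ ψ) = 0 := by
    rw [← map_nsmul, hk, map_zero]
  have hzero := eq_zero_of_pow_smul_eq_zero N γ hgen hcontĀ p htor hnp hmem hpk
  rw [ResKernel.resH1Hom_id_oneCocycleClass red hred ψ] at hzero
  obtain ⟨ā, hā⟩ := (oneCocycleClass_eq_zero_iff _ _).mp hzero
  have hā' : ∀ g, red (ψ.1 g) = g • ā - ā := fun g ↦ by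
    have h := hā g
    rw [ResKernel.pullback_id_apply red hred] at h
    exact h
  obtain ⟨m, ψ', hψ', hψ'p, hψ'r⟩ :=
    exists_cocycle_ker_valued hcont red hred hsurj p hdiv₁ htor ψ hψp hā'
  exact ⟨m, ψ', hψ', hψ'p, hψ'r⟩

omit [TopologicalSpace A] [DiscreteTopology A] [TopologicalSpace G] [IsTopologicalGroup G] in
/-- `p`-torsion of `A/A₁` lifts to `A[p]` modulo `A₁` when `A₁` is `p`-divisible: if `p • a ∈ A₁`
then `a ≡ t (mod A₁)` for some `t` with `p • t = 0`. [folklore] -/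
theorem exists_psmul_eq_zero_sub_mem (p : ℕ) (A₁ : AddSubgroup A)
    (hdiv₁ : ∀ a ∈ A₁, ∃ b ∈ A₁, p • b = a) {a : A} (ha : p • a ∈ A₁) :
    ∃ t : A, p • t = 0 ∧ a - t ∈ A₁ := by
  obtain ⟨b, hb, hpb⟩ := hdiv₁ _ ha
  exact ⟨a - b, by rw [smul_sub, hpb, sub_self], by rw [sub_sub_cancel]; exact hb⟩

set_option maxHeartbeats 800000 in
/-- **Dévissage along a `G`-stable subgroup `A₁ ≤ A`** ("`E₁(K̄_v)`, the kernel of reduction of a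
good model; Greenberg's `C = A₁[p^∞]`, `D = (A/A₁)[p^∞]`"). Hypotheses: `N ⊴ G`, `γ` and `N`
generating `G` topologically, `A` a discrete `G`-module with continuous orbit maps; `A₁` is
`G`-stable; (div) `A` is `p`-divisible; (div₁) `A₁` is `p`-divisible; (tor) every `a ∈ A` has a
positive multiple in `A₁`; (np) **no `p`-torsion in `(A/A₁)^N`**: an element whose `N`-conjugates
are congruent to it and whose `p`-th multiple lies in `A₁` lies in `A₁` (for the elliptic dévissage
this is `D[p]^N = 0`: reduce to `a ∈ A[p]` by `exists_psmul_eq_zero_sub_mem`). Then every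
`x ∈ ker (H¹(G, A) → H¹(N, A))` with `p ^ k • x = 0` is the class of a cocycle with values in
`A₁ ∩ A[p^m]` for some `m`. The quotient `Ā = A/A₁` with its induced discrete `G`-action is built
inside the proof, exactly as in the tree's `ResKernel.finite_primary_subgroupResKer_of_stableSubgroup`.
[cite: GreenbergLNM1716, §3 Lemma 3.4 (p. 89, diagram (5))] -/
theorem exists_kerValued_cocycle_of_pow_smul_eq_zero (N : Subgroup G) [N.Normal] (γ : G)
    (hgen : ∀ U : Subgroup G, IsOpen (U : Set G) → N ≤ U → γ ∈ U → U = ⊤)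
    (hcont : ∀ a : A, Continuous fun g : G ↦ g • a) (p : ℕ) [hp : Fact p.Prime]
    (A₁ : AddSubgroup A) (hA₁ : ∀ (g : G) (a : A), a ∈ A₁ → g • a ∈ A₁)
    (hdiv : ∀ a : A, ∃ b : A, p • b = a)
    (hdiv₁ : ∀ a ∈ A₁, ∃ b ∈ A₁, p • b = a)
    (htor : ∀ a : A, ∃ n : ℕ, 0 < n ∧ n • a ∈ A₁)
    (hnp : ∀ a : A, (∀ n ∈ N, n • a - a ∈ A₁) → p • a ∈ A₁ → a ∈ A₁)
    {x : discreteH1 G A} (hx : x ∈ subgroupResKer A N) {k : ℕ} (hk : p ^ k • x = 0) :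
    ∃ (m : ℕ) (ψ : contOneCocycles (discreteTopRep G A)),
      oneCocycleClass _ ψ = x ∧ (∀ g, p ^ m • ψ.1 g = 0) ∧ ∀ g, ψ.1 g ∈ A₁ := by
  -- the quotient `Ā = A / A₁` with its induced `G`-action
  have hle : ∀ g : G, A₁ ≤ A₁.comap (DistribSMul.toAddMonoidHom A g) :=
    fun g a ha ↦ hA₁ g a ha
  letI iDMA : DistribMulAction G (A ⧸ A₁) :=
    { smul := fun g ↦ QuotientAddGroup.map A₁ A₁ (DistribSMul.toAddMonoidHom A g) (hle g)
      one_smul := fun x ↦ QuotientAddGroup.induction_on x fun a ↦ by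
        change QuotientAddGroup.map A₁ A₁ (DistribSMul.toAddMonoidHom A 1) (hle 1)
          (QuotientAddGroup.mk a) = QuotientAddGroup.mk a
        rw [QuotientAddGroup.map_mk, DistribSMul.toAddMonoidHom_apply, one_smul]
      mul_smul := fun g h x ↦ QuotientAddGroup.induction_on x fun a ↦ by
        change QuotientAddGroup.map A₁ A₁ (DistribSMul.toAddMonoidHom A (g * h)) (hle (g * h))
            (QuotientAddGroup.mk a) =
          QuotientAddGroup.map A₁ A₁ (DistribSMul.toAddMonoidHom A g) (hle g)
            (QuotientAddGroup.map A₁ A₁ (DistribSMul.toAddMonoidHom A h) (hle h)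
              (QuotientAddGroup.mk a))
        rw [QuotientAddGroup.map_mk, QuotientAddGroup.map_mk, QuotientAddGroup.map_mk,
          DistribSMul.toAddMonoidHom_apply, DistribSMul.toAddMonoidHom_apply,
          DistribSMul.toAddMonoidHom_apply, mul_smul]
      smul_zero := fun g ↦
        map_zero (QuotientAddGroup.map A₁ A₁ (DistribSMul.toAddMonoidHom A g) (hle g))
      smul_add := fun g ↦
        map_add (QuotientAddGroup.map A₁ A₁ (DistribSMul.toAddMonoidHom A g) (hle g)) }
  letI : TopologicalSpace (A ⧸ A₁) := ⊥
  haveI : DiscreteTopology (A ⧸ A₁) := ⟨rfl⟩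
  set red : A →+ A ⧸ A₁ := QuotientAddGroup.mk' A₁ with hred_def
  have hsmul_mk : ∀ (g : G) (a : A), g • red a = red (g • a) := fun g a ↦ by
    change QuotientAddGroup.map A₁ A₁ (DistribSMul.toAddMonoidHom A g) (hle g)
      (QuotientAddGroup.mk a) = QuotientAddGroup.mk (g • a)
    rw [QuotientAddGroup.map_mk, DistribSMul.toAddMonoidHom_apply]
  have hred : ∀ (g : G) (a : A), red (g • a) = g • red a := fun g a ↦ (hsmul_mk g a).symm
  have hred0 : ∀ a : A, red a = 0 ↔ a ∈ A₁ := fun a ↦ QuotientAddGroup.eq_zero_iff a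
  have hsurj : Function.Surjective red := QuotientAddGroup.mk'_surjective A₁
  -- `Ā` is a discrete `G`-module
  have hcontĀ : ∀ ā : A ⧸ A₁, Continuous fun g : G ↦ g • ā := by
    intro ā
    obtain ⟨a, rfl⟩ := hsurj ā
    have e : (fun g : G ↦ g • red a) = red ∘ fun g : G ↦ g • a := by
      ext g; exact hsmul_mk g a
    rw [e]
    exact continuous_of_discreteTopology.comp (hcont a)
  -- (div₁), (tor), (np) in quotient form
  have hdiv₁' : ∀ a : A, red a = 0 → ∃ b : A, red b = 0 ∧ p • b = a := by
    intro a ha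
    obtain ⟨b, hb, hpb⟩ := hdiv₁ a ((hred0 a).mp ha)
    exact ⟨b, (hred0 b).mpr hb, hpb⟩
  have htor' : ∀ ā : A ⧸ A₁, IsOfFinAddOrder ā := by
    intro ā
    obtain ⟨a, rfl⟩ := hsurj ā
    obtain ⟨n, hn, hna⟩ := htor a
    exact isOfFinAddOrder_iff_nsmul_eq_zero.mpr ⟨n, hn, by rw [← map_nsmul]; exact (hred0 _).mpr hna⟩
  have hnp' : ∀ ā : A ⧸ A₁, (∀ n ∈ N, n • ā = ā) → p • ā = 0 → ā = 0 := by
    intro ā hāN hpā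
    obtain ⟨a, rfl⟩ := hsurj ā
    rw [hred0]
    refine hnp a (fun n hn ↦ ?_) ?_
    · rw [← hred0, map_sub, hred, sub_eq_zero]
      exact hāN n hn
    · rw [← hred0, map_nsmul]
      exact hpā
  obtain ⟨m, ψ, hψx, hψp, hψr⟩ := exists_kerValued_cocycle_of_pow_smul_eq_zero_of_red N γ hgen
    hcont hcontĀ red hred hsurj p hdiv hdiv₁' htor' hnp' hx hk
  exact ⟨m, ψ, hψx, hψp, fun g ↦ (hred0 _).mp (hψr g)⟩

end ResKernelPrimary

end Summit.BirchSwinnertonDyer.Rank1Residual.Iwasawa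

end
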